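import Summits.AtomisticToContinuum.HydrodynamicLimit.Theorems.LambertianContactSwapSwapGapLiouvilleInvarianceLambda
import Summits.AtomisticToContinuum.HydrodynamicLimit.Theorems.LambertianContactSwapLambertianEulerLiouvilleOfWindow
import Summits.AtomisticToContinuum.HydrodynamicLimit.Theorems.LambertianContactSwapLambertianEulerFreshTail
import Literature.MathematicalPhysics.KineticTheory.LambertianRedrawNondegenerate
import HarnessLib

/-!
# Semigroup in law of the Lambertian gas (crux `LambertianEuler`, stmt-AtomisticToContinuum-11854, line `Sketch`, stub `stub_lawSemigroupLambda`)

The Lambertian (cosine-redraw) hard-sphere flow `Λ_t(z; ξs) = lambertFlow G ε ξs z t` of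
`Literature.MathematicalPhysics.KineticTheory.LambertianHardSphereFlow` is driven by the i.i.d.
Gaussian noise `ξs ∼ γ^ℕ = lambertNoise`.  The registered stub `stub_lawSemigroupLambda` is the
**Chapman–Kolmogorov identity in law** needed to restart Yau's relative-entropy method window by
window: for `N + 1` spheres of diameter `hsDiameter σ N` on `𝕋³` (`0 < σ < 1/2`), a finite initial
law `P ≪ liouville` and `s, w ≥ 0`,
`(P ⊗ γ^ℕ) ∘ Λ_{s+w}⁻¹ = (((P ⊗ γ^ℕ) ∘ Λ_s⁻¹) ⊗ γ^ℕ) ∘ Λ_w⁻¹`,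
i.e. the law of `Λ_{s+w}` is the law of `Λ_w` run with FRESH noise from the law of `Λ_s`.

Proof route (the calc block of
`…LambertianEulerLiouvilleOfWindow.map_lambertFlow_add_eq` without its two final invariance
rewrites, first for an arbitrary geometry and initial measure `L`, `map_lambertFlow_add_eq_map`):
both sides are compared through `Measure.ext_of_lintegral`; for measurable `f ≥ 0`,
`∫ f d((L ⊗ γ^ℕ) ∘ Λ_{s+w}⁻¹) = ∫ dL(z) ∫ dγ^ℕ(ξs) f(Λ_{s+w}(z; ξs))` (`lintegral_map`,
`lintegral_prod`) `= ∫ dL(z) ∫ dγ^ℕ(ξs) f(Λ_w(Λ_s(z; ξs); ξs (· + K_s)))` (pathwise cocycle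
`lambertFlow_add_eq_restart` off the accumulation set, which is `L ⊗ γ^ℕ`-null)
`= ∫ dL(z) ∫ dγ^ℕ(ξs) ∫ dγ^ℕ(ηs) f(Λ_w(Λ_s(z; ξs); ηs))` (fresh-tail / strong Markov identity)
`= ∫ f d((((L ⊗ γ^ℕ) ∘ Λ_s⁻¹) ⊗ γ^ℕ) ∘ Λ_w⁻¹)` (undo `lintegral_prod`, `lintegral_map` twice).
On `𝕋³` the three standing inputs are: joint measurability of `Λ_t`
(`measurable_lambertFlow_hsDiameter`), `liouville ⊗ γ^ℕ`-a.e. non-accumulation of the collision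
instants (`…SwapGapLiouvilleInvarianceLambda.nonAccumulationLambda`, transported to `P ⊗ γ^ℕ` by
`P ≪ liouville`, `Measure.AbsolutelyContinuous.prod`) and the fresh-tail identity
(`…LambertianEulerFreshTail.lambertFlow_freshTail`, torus regularity
`Torus.isHardSphereRegular_geometry` for `hsDiameter σ N ≤ σ < 1/2`).

References: pure measure theory on top of the landed Λ-Liouville theorem; the Markov property in
law of a piecewise-deterministic process driven by i.i.d. redraws is [folklore]
(cf. Gallagher–Saint-Raymond–Texier 2013, Ch. 4, for the hard-sphere bookkeeping).
-/

noncomputable section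

namespace Summit.AtomisticToContinuum.HydrodynamicLimit.Theorems.LambertianContactSwapLambertianEulerLawSemigroup

open scoped BigOperators Topology ENNReal InnerProductSpace
open MeasureTheory ProbabilityTheory Filter Set InformationTheory
open Literature.MathematicalPhysics.KineticTheory
open Literature.Analysis.FluidPDE Literature.Analysis.FluidPDE.Alexander
open Summit.AtomisticToContinuum.HydrodynamicLimit.Theorems.LambertianContactSwapLambertianEulerLiouvilleOfWindow
open Summit.AtomisticToContinuum.HydrodynamicLimit.Theorems.LambertianContactSwapLambertianEulerFreshTail
open Summit.AtomisticToContinuum.HydrodynamicLimit.Theorems.LambertianContactSwapSwapGapLiouvilleInvarianceLambda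

/-! ## The semigroup step in law, any geometry and any initial measure -/

section Step

variable {d : Type*} [Fintype d] {X : Type*} [MeasurableSpace X] {N : ℕ} {G : Geometry d X} {ε : ℝ}

/-- **Chapman–Kolmogorov in law for the annealed Lambertian flow** (any geometry, any initial
measure `L` on phase space): granted joint measurability of every `Λ_t`, `L ⊗ γ^ℕ`-a.e.
non-accumulation of the collision instants and the fresh-tail identity (for fixed `z`, the noise
shifted by `K_t` is again `γ^ℕ` and independent of `Λ_t(z; ·)`, in `lintegral` form), for
`s, u ≥ 0` the law of `Λ_{s+u}` under `L ⊗ γ^ℕ` is the law of `Λ_u` run with fresh noise from the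
law of `Λ_s`: `(L ⊗ γ^ℕ) ∘ Λ_{s+u}⁻¹ = (((L ⊗ γ^ℕ) ∘ Λ_s⁻¹) ⊗ γ^ℕ) ∘ Λ_u⁻¹`. [folklore] -/
theorem map_lambertFlow_add_eq_map (L : Measure (Config N d X)) {s u : ℝ} (hs : 0 ≤ s)
    (hu : 0 ≤ u)
    (hmeas : ∀ t : ℝ, Measurable fun p : Config N d X × (ℕ → EuclideanSpace ℝ d) =>
      lambertFlow G ε p.2 p.1 t)
    (hacc : ∀ᵐ p ∂(L.prod (lambertNoise d)),
      ∀ T : ℝ, ∃ k, ENNReal.ofReal T < lambertInstant G ε p.2 p.1 k)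
    (hfresh : ∀ {H : Config N d X × (ℕ → EuclideanSpace ℝ d) → ℝ≥0∞}, Measurable H →
      ∀ (z : Config N d X) (t : ℝ), 0 ≤ t →
        (∀ᵐ ξs ∂(lambertNoise d), ∃ k, ENNReal.ofReal t < lambertInstant G ε ξs z k) →
        ∫⁻ ξs, H (lambertFlow G ε ξs z t, fun n => ξs (n + lambertCount G ε ξs z t))
            ∂(lambertNoise d) =
          ∫⁻ ξs, (∫⁻ ηs, H (lambertFlow G ε ξs z t, ηs) ∂(lambertNoise d)) ∂(lambertNoise d)) :
    (L.prod (lambertNoise d)).map (fun p => lambertFlow G ε p.2 p.1 (s + u)) =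
      ((((L.prod (lambertNoise d)).map (fun p => lambertFlow G ε p.2 p.1 s)).prod
          (lambertNoise d)).map (fun p => lambertFlow G ε p.2 p.1 u)) := by
  refine Measure.ext_of_lintegral _ fun f hf => ?_
  have hfu : Measurable fun q : Config N d X × (ℕ → EuclideanSpace ℝ d) =>
      f (lambertFlow G ε q.2 q.1 u) := hf.comp (hmeas u)
  have hF : Measurable fun w : Config N d X =>
      ∫⁻ ηs, f (lambertFlow G ε ηs w u) ∂(lambertNoise d) :=
    hfu.lintegral_prod_right'
  have hacc' : ∀ᵐ z ∂L, ∀ᵐ ξs ∂(lambertNoise d),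
      ∀ T : ℝ, ∃ k, ENNReal.ofReal T < lambertInstant G ε ξs z k :=
    Measure.ae_ae_of_ae_prod hacc
  calc ∫⁻ w, f w ∂(L.prod (lambertNoise d)).map (fun p => lambertFlow G ε p.2 p.1 (s + u))
      = ∫⁻ p, f (lambertFlow G ε p.2 p.1 (s + u)) ∂(L.prod (lambertNoise d)) :=
        lintegral_map hf (hmeas (s + u))
    _ = ∫⁻ z, (∫⁻ ξs, f (lambertFlow G ε ξs z (s + u)) ∂(lambertNoise d)) ∂L :=
        lintegral_prod _ (hf.comp (hmeas (s + u))).aemeasurable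
    _ = ∫⁻ z, (∫⁻ ξs, (∫⁻ ηs, f (lambertFlow G ε ηs (lambertFlow G ε ξs z s) u)
          ∂(lambertNoise d)) ∂(lambertNoise d)) ∂L := by
        refine lintegral_congr_ae (hacc'.mono fun z hz => ?_)
        have hzS : ∀ᵐ ξs ∂(lambertNoise d), ∃ k, ENNReal.ofReal s < lambertInstant G ε ξs z k :=
          hz.mono fun ξs h => h s
        have key : ∫⁻ ξs, f (lambertFlow G ε (fun n => ξs (n + lambertCount G ε ξs z s))
              (lambertFlow G ε ξs z s) u) ∂(lambertNoise d) =
            ∫⁻ ξs, (∫⁻ ηs, f (lambertFlow G ε ηs (lambertFlow G ε ξs z s) u)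
              ∂(lambertNoise d)) ∂(lambertNoise d) :=
          hfresh hfu z s hs hzS
        refine Eq.trans ?_ key
        refine lintegral_congr_ae (hz.mono fun ξs h => ?_)
        show f (lambertFlow G ε ξs z (s + u)) = f (lambertFlow G ε
          (fun n => ξs (n + lambertCount G ε ξs z s)) (lambertFlow G ε ξs z s) u)
        rw [lambertFlow_add_eq_restart (ξs := ξs) (z := z) hs hu (h s) (h (s + u))]
    _ = ∫⁻ p, (∫⁻ ηs, f (lambertFlow G ε ηs (lambertFlow G ε p.2 p.1 s) u) ∂(lambertNoise d))
          ∂(L.prod (lambertNoise d)) :=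
        (lintegral_prod _ (hF.comp (hmeas s)).aemeasurable).symm
    _ = ∫⁻ w, (∫⁻ ηs, f (lambertFlow G ε ηs w u) ∂(lambertNoise d))
          ∂(L.prod (lambertNoise d)).map (fun p => lambertFlow G ε p.2 p.1 s) :=
        (lintegral_map hF (hmeas s)).symm
    _ = ∫⁻ p, f (lambertFlow G ε p.2 p.1 u)
          ∂(((L.prod (lambertNoise d)).map (fun p => lambertFlow G ε p.2 p.1 s)).prod
            (lambertNoise d)) :=
        (lintegral_prod _ hfu.aemeasurable).symm
    _ = ∫⁻ w, f w ∂(((L.prod (lambertNoise d)).map (fun p => lambertFlow G ε p.2 p.1 s)).prod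
            (lambertNoise d)).map (fun p => lambertFlow G ε p.2 p.1 u) :=
        (lintegral_map hf (hmeas u)).symm

end Step

/-! ## The registered stub -/

/-- **Registered stub `stub_lawSemigroupLambda` of line `Sketch`** (crux
`LambertianContactSwap.LambertianEuler`, stmt-AtomisticToContinuum-11854): semigroup (Markov)
property IN LAW of the Lambertian hard-sphere gas of `N + 1` spheres of diameter `hsDiameter σ N`
on `𝕋³`, `0 < σ < 1/2`.  For a finite initial law `P ≪ liouville` and `s, w ≥ 0`, the law of
`Λ_{s+w}` under `P ⊗ γ^ℕ` equals the law of `Λ_w` run with fresh noise `γ^ℕ` from the law of `Λ_s`: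
`(P ⊗ γ^ℕ) ∘ Λ_{s+w}⁻¹ = (((P ⊗ γ^ℕ) ∘ Λ_s⁻¹) ⊗ γ^ℕ) ∘ Λ_w⁻¹`.  Instance of
`map_lambertFlow_add_eq_map` on the torus: measurability `measurable_lambertFlow_hsDiameter`,
a.e. non-accumulation `nonAccumulationLambda` transported along `P ≪ liouville`, fresh tail
`lambertFlow_freshTail`. [folklore] -/
theorem stub_lawSemigroupLambda :
    ∀ {σ : ℝ}, 0 < σ → σ < 2⁻¹ → ∀ (N : ℕ) (P : Measure (Config (N + 1) (Fin 3) T3)) [IsFiniteMeasure P],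
      P ≪ liouville (Torus.geometry (Fin 3)) (N + 1) (hsDiameter σ N) →
      ∀ s w : ℝ, 0 ≤ s → 0 ≤ w →
        (P.prod (lambertNoise (Fin 3))).map
            (fun p => lambertFlow (Torus.geometry (Fin 3)) (hsDiameter σ N) p.2 p.1 (s + w)) =
          ((((P.prod (lambertNoise (Fin 3))).map
              (fun p => lambertFlow (Torus.geometry (Fin 3)) (hsDiameter σ N) p.2 p.1 s)).prod
              (lambertNoise (Fin 3))).map
            (fun p => lambertFlow (Torus.geometry (Fin 3)) (hsDiameter σ N) p.2 p.1 w)) := by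
  intro σ hσ hσ' N P _ hP s w hs hw
  have hε : 0 < hsDiameter σ N := hsDiameter_pos hσ N
  have hε' : hsDiameter σ N < 2⁻¹ := (hsDiameter_le hσ.le N).trans_lt hσ'
  have hG : (Torus.geometry (Fin 3)).IsHardSphereRegular (hsDiameter σ N) :=
    Torus.isHardSphereRegular_geometry hε'
  have hGm : (Torus.geometry (Fin 3)).IsMeasurable := Torus.isMeasurable_geometry
  have hAC : P.prod (lambertNoise (Fin 3)) ≪
      (liouville (Torus.geometry (Fin 3)) (N + 1) (hsDiameter σ N)).prod (lambertNoise (Fin 3)) :=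
    hP.prod Measure.AbsolutelyContinuous.rfl
  have hacc : ∀ᵐ p ∂(P.prod (lambertNoise (Fin 3))), ∀ T : ℝ, ∃ k,
      ENNReal.ofReal T < lambertInstant (Torus.geometry (Fin 3)) (hsDiameter σ N) p.2 p.1 k :=
    hAC.ae_le (nonAccumulationLambda (hsDiameter σ N) hε hε' (N + 1))
  exact map_lambertFlow_add_eq_map P hs hw (measurable_lambertFlow_hsDiameter hσ.le hσ' N) hacc
    (fun hH z t ht hgood => lambertFlow_freshTail hG hGm hH z t ht hgood)

end Summit.AtomisticToContinuum.HydrodynamicLimit.Theorems.LambertianContactSwapLambertianEulerLawSemigroup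

end
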